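import Summits.QuantumFields.BalabanUV.T4Continuum.Spine.NE2BalabanThreshold
import Summits.QuantumFields.BalabanUV.T4Continuum.Support.CovariantLaplacianSharpRate
import Summits.QuantumFields.BalabanUV.T4Continuum.Support.AveragingSummandRate
import Summits.QuantumFields.BalabanUV.T4Continuum.Support.GaugeTermSlotRegularRate

/-!
# T⁴ programme, spine node NE2 (U1a), tier B row B8 «general rate», PART 4 — THE END: ROOT B OF RECORD RE-TYPED AT A GENERAL GEOMETRIC
# RATE `θ ∈ [L⁻¹, 1)` (owner rulings R17 (c) / R19 (c); closer (M1′), STRUCTURE half, of the located currency gap GAPS `G-ne2leaf08g2-1`)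

NE2 formalisation swarm `b2b-balaban-t4-ne2-formalise-*`, leaf prover 08 (gen 2; row B7 / B8 lineage; INTENT CLAIMS.log 2026-08-20; part 4 holder
by R19 (c)).  Inputs BY NAME, all LANDED: part 4a `CovariantLaplacianSharpRate.perturbationLaws_covariantLaplacian_of_regular_sharp_rate` (B2/B5
slot, SHARP κ, at rate θ; on part 1's structures, leaf-07-g3), part 2 `AveragingSummandRate.perturbationLaws_avgPert_of_regular_rate` (B3 slot at θ,
this seat), part 3 (B4 gauge slot at θ, leaf-05-g4), `NE2BalabanLayer.perturbationLaws_add₃` (ρ-generic), the owner's general-rate engine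
`NE2ColourPerturbedLayerRate.towerLimitRate_perturbed_king_kron_rate` (p216739), and the θ-FREE threshold arithmetic of the instance of record
`NE2BalabanLayerSharp.kappaBs_balaban_le_of_small` / `NE2BalabanThreshold.smallness_of_le` (`etaStar` does not see θ).

WHAT THIS FILE PROVES (bookkeeping; every constant letter-for-letter the record's — `kappaBs`, `C2Bs`, `kappaQ`, `C2gram`, `epsR`, `CdeltaR`, `theta0`,
`kappa4F`, `C4F`, `etaStar` — the rate alone moved from `L⁻¹` to `θ`):
 * §1 `perturbationLaws_tierB_sharp_rate` (the three slots summed at rate θ, generic `hP₃`, `hP₄`), `perturbationLaws_balaban_sharp_rate` (`hP₃`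
   DISCHARGED by part 2; generic gauge slot `hP₄`), `balaban_rate_sharp_rate` (every `‖t‖κ < 1`) and `balaban_rate_at_one_sharp_rate` /
   `balaban_rate_of_small_sharp_rate` (`t = 1` under the record's explicit numbers);
 * §2 ON ROW DATA: **`perturbationLaws_balaban_final_rate (hd) (hreg) (hC) (hθ : L⁻¹ ≤ θ) (hθle : θ ≤ 1) (hNE3θ) (ha′) (hκ) (hsmall)`** — the
   twin of `NE2BalabanFinal.perturbationLaws_balaban_final` (gauge slot `hP₄ :=` part 3's
   `GaugeTermSlotRegularRate.perturbationLaws_gaugeSlot_regular_rate`, leaf-05-g4), `balaban_final_rate_of_small_rate`, and THE END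
   **`balaban_final_rate_of_regular_rate (hd) (hreg) (hC) (hθ : L⁻¹ ≤ θ) (hθ1 : θ < 1) (hNE3θ) (ha′) (hαη) (hβη)
   (hη : η ≤ etaStar o d a a′) : TowerLimitRate (Qlev ⊗ 1) L^d (k ↦ (Δ_a^{(k)} ⊗ 1 + balabanPert (liftR Rg) (gaugeSlot …) k)⁻¹) (Cpert …)
   θ`** — owner ruling R19 (c)'s signature
   (its `hL : 2 ≤ L` is implied by `L⁻¹ ≤ θ < 1` and therefore not a binder, as in parts 1/4a; every other binder of
   `NE2BalabanThreshold.balaban_final_rate_of_regular` kept, the rate alone moved); a kernel `example` re-derives the record's `θ = L⁻¹` statement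
   from it by `exact` (`L ≥ 2` for `L⁻¹ < 1`).
HONEST FRAMING (T4-DAG p. 1).  Composition BY NAME at MODEL LEVEL (transporters `Rg` DATA; GLOBAL small field; no assertion that `Rg` is Bałaban's
minimiser — no B0, c5); node NE3's `LocalRate … C θ` is a DISPLAYED binder consumed BY NAME (c2/c7) — whether NE3 can supply sup currency at some
`θ > L⁻¹` is the OPEN content side of G-ne2leaf08g2-1; ROOT B of record (`θ = L⁻¹`) neither edited nor superseded and CONDITIONAL (c1/c2/c3/c7) exactly
as before; finite torus, linear layer, operator norm; NOT [B9] (3.23)–(3.26) as printed; **NE2 (U1a) NOT PROVED**; spine PROVED 0/9 unchanged; NOT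
infinite volume, NOT a mass gap, NOT Clay.  HONEST DEPENDENCY: continuum YM on T⁴ ⇐ BetaPertH ∧ nine spine estimates (0/9 proved); BetaPertH ⇐ (D1) ∧
(D4) ∧ CAP+tail; G-an2-4 gates asym, D1 and NE2/3/4.  ABSOLUTE RULE kept; no `def … : Prop` fact; no new definition; no `sorry`.
-/

noncomputable section

open scoped BigOperators ComplexConjugate Matrix Matrix.Norms.L2Operator Kronecker
open Filter Topology

namespace Summit.QuantumFields.BalabanUV.T4Continuum.NE2BalabanFinalRate

open Literature.MathematicalPhysics.QuantumFieldTheory.Balaban1983to89.B5Prop11Plancherel (Cst Cst_nonneg Tor fine)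
open Literature.MathematicalPhysics.QuantumFieldTheory.Balaban1983to89.B5G183RateUnitTower (lev lev_neZero)
open Literature.MathematicalPhysics.QuantumFieldTheory.Balaban1983to89.T4EtaRateMin (LocalRate)
open Summit.QuantumFields.BalabanUV.T4Continuum
open Summit.QuantumFields.BalabanUV.T4Continuum.CovariantAveragingTower (TowerLimitRate)
open Summit.QuantumFields.BalabanUV.T4Continuum.BalabanAveragedTowerUnit (idx Qlev)
open Summit.QuantumFields.BalabanUV.T4Continuum.BackgroundResolventTower
open Summit.QuantumFields.BalabanUV.T4Continuum.KingPairingPlantedLaw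
open Summit.QuantumFields.BalabanUV.T4Continuum.GramPerturbationLaw (AveragingLaws C2gram)
open Summit.QuantumFields.BalabanUV.T4Continuum.PerturbationAlgebra (perturbationLaws_mono)
open Summit.QuantumFields.BalabanUV.T4Continuum.NE2FromNE3 (bgReadings)
open Summit.QuantumFields.BalabanUV.T4Continuum.RegularBackgroundTower (RegularTransporters regClass betaNE3)
open Summit.QuantumFields.BalabanUV.T4Continuum.CovariantBlockAveraging (Ecov)
open Summit.QuantumFields.BalabanUV.T4Continuum.CovariantAveragingSummand (kappaQ kappaQ_ofReal)
open Summit.QuantumFields.BalabanUV.T4Continuum.GaugeTermPerturbationLaw (deltaK)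
open Summit.QuantumFields.BalabanUV.T4Continuum.GaugeTermScalarData (QuT Q1)
open Summit.QuantumFields.BalabanUV.T4Continuum.GaugeTermInstanceGeom (gS)
open Summit.QuantumFields.BalabanUV.T4Continuum.ScalarAveragedCompression (sigma0)
open Summit.QuantumFields.BalabanUV.T4Continuum.ScalarCovariantLaplacian (kappaS)
open Summit.QuantumFields.BalabanUV.T4Continuum.RegularSiteTransporters (siteT)
open Summit.QuantumFields.BalabanUV.T4Continuum.NestedContourTransport (theta0)
open Summit.QuantumFields.BalabanUV.T4Continuum.NE2BalabanLayer (tierBPert perturbationLaws_add₃)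
open Summit.QuantumFields.BalabanUV.T4Continuum.NE2BalabanRoot (avgPert balabanPert)
open Summit.QuantumFields.BalabanUV.T4Continuum.NE2BalabanGauge (gaugeSlot liftR)
open Summit.QuantumFields.BalabanUV.T4Continuum.NE2BalabanLayerSharp (kappaBs C2Bs KstarR kappaBs_balaban_le_of_small)
open Summit.QuantumFields.BalabanUV.T4Continuum.NE2BalabanWiring (epsR CdeltaR epsR_nonneg)
open Summit.QuantumFields.BalabanUV.T4Continuum.NE2BalabanFinal (tauR kappa4F C4F)
open Summit.QuantumFields.BalabanUV.T4Continuum.NE2BalabanThreshold (etaStar smallness_of_le)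
open Summit.QuantumFields.BalabanUV.T4Continuum.NE2ColourPerturbedLayerRate (towerLimitRate_perturbed_king_kron_rate)
open Summit.QuantumFields.BalabanUV.T4Continuum.CovariantLaplacianSharpRate (perturbationLaws_covariantLaplacian_of_regular_sharp_rate)
open Summit.QuantumFields.BalabanUV.T4Continuum.AveragingSummandRate (perturbationLaws_avgPert_of_regular_rate)

variable {d : ℕ} (L : ℕ) [NeZero L] (M : Fin d → ℕ) [hM : ∀ μ, NeZero (M μ)] (a : ℝ) (ha : 0 < a)
variable {o : Type*} [Fintype o] [DecidableEq o]

/-! ## §1 The assembled tier-B perturbation at rate `θ`, sharp `κ` -/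

/-- **THE ASSEMBLED TIER-B PERTURBATION IN THE TARGET SHAPE AT RATE `θ`, SHARP `κ`** (`d ≥ 1`, `L⁻¹ ≤ θ`): part 4a's sharp B2/B5 face plus two summand
laws `hP₃`, `hP₄` at rate `θ` (displayed) — `NE2BalabanLayerSharp.perturbationLaws_tierB_sharp` with `hNE3` allowed at rate `θ`; SAME `kappaBs`, `C2Bs`.
[folklore] -/
theorem perturbationLaws_tierB_sharp_rate (hd : 1 ≤ d) {R : (k : ℕ) → Fin d → (idx L M k → Matrix o o ℂ)} {α β : ℝ}
    (hreg : RegularTransporters L M R α β) {C θ : ℝ} (hC : 0 ≤ C) (hθ : ((L : ℝ)⁻¹) ≤ θ)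
    (hNE3θ : LocalRate (bgReadings L M (regClass L M R)) C θ)
    {P₃ P₄ : (k : ℕ) → Matrix (idx L M k × o) (idx L M k × o) ℂ} {κ₃ C₃ κ₄ C₄ : ℝ}
    (hP₃ : PerturbationLaws (fun k => calDalev L M a ha k ⊗ₖ (1 : Matrix o o ℂ)) P₃ (fun k => JpcT L M k ⊗ₖ (1 : Matrix o o ℂ)) κ₃
      (fun k => C₃ * θ ^ k))
    (hP₄ : PerturbationLaws (fun k => calDalev L M a ha k ⊗ₖ (1 : Matrix o o ℂ)) P₄ (fun k => JpcT L M k ⊗ₖ (1 : Matrix o o ℂ)) κ₄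
      (fun k => C₄ * θ ^ k)) :
    PerturbationLaws (fun k => calDalev L M a ha k ⊗ₖ (1 : Matrix o o ℂ)) (tierBPert L M R P₃ P₄)
      (fun k => JpcT L M k ⊗ₖ (1 : Matrix o o ℂ)) (kappaBs o d a α β κ₃ κ₄) (fun k => C2Bs o d L a α β C C₃ C₄ * θ ^ k) :=
  perturbationLaws_add₃ (perturbationLaws_covariantLaplacian_of_regular_sharp_rate L M a ha hd hreg hC hθ hNE3θ) hP₃ hP₄

/-- **`balabanPert R P₄` IN THE TARGET SHAPE AT RATE `θ`, SHARP `κ`, B3 SLOT DISCHARGED** (`d ≥ 1`, `L⁻¹ ≤ θ`): `hP₃ :=` part 2's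
`perturbationLaws_avgPert_of_regular_rate` (the free inner-pairing law and the transport-error laws both inside); the gauge-slot law `hP₄` at rate `θ`
displayed.  SAME `κ = kappaBs … (kappaQ d a a (epsR o d α)) κ₄`, SAME `C₂ = C2Bs … (a·C2gram … (CdeltaR … (theta0 …))) C₄` as
`NE2BalabanFinal.perturbationLaws_balaban_final`'s inner letters. [cite: Balaban1985BackgroundPropagators, (3.26) p.395 (shape)] [folklore] -/
theorem perturbationLaws_balaban_sharp_rate (hd : 1 ≤ d) {R : (k : ℕ) → Fin d → (idx L M k → Matrix o o ℂ)} {α β : ℝ}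
    (hreg : RegularTransporters L M R α β) {C θ : ℝ} (hC : 0 ≤ C) (hθ : ((L : ℝ)⁻¹) ≤ θ)
    (hNE3θ : LocalRate (bgReadings L M (regClass L M R)) C θ)
    {P₄ : (k : ℕ) → Matrix (idx L M k × o) (idx L M k × o) ℂ} {κ₄ C₄ : ℝ}
    (hP₄ : PerturbationLaws (fun k => calDalev L M a ha k ⊗ₖ (1 : Matrix o o ℂ)) P₄ (fun k => JpcT L M k ⊗ₖ (1 : Matrix o o ℂ)) κ₄
      (fun k => C₄ * θ ^ k)) :
    PerturbationLaws (fun k => calDalev L M a ha k ⊗ₖ (1 : Matrix o o ℂ)) (balabanPert L M a R P₄)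
      (fun k => JpcT L M k ⊗ₖ (1 : Matrix o o ℂ)) (kappaBs o d a α β (kappaQ d a (a : ℂ) (epsR o d α)) κ₄)
      (fun k => C2Bs o d L a α β C
        (a * C2gram (Cst d a) 1 (epsR o d α) (2 * d * Cst d a) (CJ d a) (Cst d a) (CdeltaR o d a α (theta0 d α (betaNE3 o C)))) C₄ * θ ^ k) :=
  perturbationLaws_tierB_sharp_rate L M a ha hd hreg hC hθ hNE3θ (perturbationLaws_avgPert_of_regular_rate L M a ha hreg hC hθ hNE3θ) hP₄

/-- **ROOT B AT RATE `θ` FOR EVERY COUPLING IN THE NEUMANN DISC** (`d ≥ 1`, `L⁻¹ ≤ θ < 1`, `‖t‖κ < 1`): the owner's general-rate colour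
engine on the law above — `TowerLimitRate (Qlev ⊗ 1) L^d (k ↦ (Δ_a^{(k)} ⊗ 1 + t·P_k)⁻¹) (Cpert κ (2dCst) CJ C₂ 0 t) θ`,
`P = balabanPert R P₄`, gauge slot displayed.  NE2 is NOT proved by this. [cite: King1986, Lemma 4.5 (4.32)/(4.38) p.674 (scalar template)] [folklore] -/
theorem balaban_rate_sharp_rate (hd : 1 ≤ d) {R : (k : ℕ) → Fin d → (idx L M k → Matrix o o ℂ)} {α β : ℝ}
    (hreg : RegularTransporters L M R α β) {C θ : ℝ} (hC : 0 ≤ C) (hθ : ((L : ℝ)⁻¹) ≤ θ) (hθ1 : θ < 1)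
    (hNE3θ : LocalRate (bgReadings L M (regClass L M R)) C θ)
    {P₄ : (k : ℕ) → Matrix (idx L M k × o) (idx L M k × o) ℂ} {κ₄ C₄ : ℝ}
    (hP₄ : PerturbationLaws (fun k => calDalev L M a ha k ⊗ₖ (1 : Matrix o o ℂ)) P₄ (fun k => JpcT L M k ⊗ₖ (1 : Matrix o o ℂ)) κ₄
      (fun k => C₄ * θ ^ k)) {t : ℂ} (ht : ‖t‖ * kappaBs o d a α β (a * (epsR o d α * (2 + epsR o d α) * Cst d a)) κ₄ < 1) :
    TowerLimitRate (fun k => Qlev L M k ⊗ₖ (1 : Matrix o o ℂ)) ((L : ℝ) ^ d)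
      (fun k => (calDalev L M a ha k ⊗ₖ (1 : Matrix o o ℂ) + t • balabanPert L M a R P₄ k)⁻¹)
      (Cpert (kappaBs o d a α β (a * (epsR o d α * (2 + epsR o d α) * Cst d a)) κ₄) (2 * d * Cst d a) (CJ d a)
        (C2Bs o d L a α β C
          (a * C2gram (Cst d a) 1 (epsR o d α) (2 * d * Cst d a) (CJ d a) (Cst d a) (CdeltaR o d a α (theta0 d α (betaNE3 o C)))) C₄)
        0 t) θ := by
  have h := perturbationLaws_balaban_sharp_rate L M a ha hd hreg hC hθ hNE3θ hP₄
  rw [kappaQ_ofReal ha.le] at h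
  exact towerLimitRate_perturbed_king_kron_rate L M a ha hθ hθ1 h ht

/-- **THE PHYSICAL VALUE `t = 1` AT RATE `θ`, SHARP THRESHOLD** `kappaBs … < 1` (free of NE3's constant). [folklore] -/
theorem balaban_rate_at_one_sharp_rate (hd : 1 ≤ d) {R : (k : ℕ) → Fin d → (idx L M k → Matrix o o ℂ)} {α β : ℝ}
    (hreg : RegularTransporters L M R α β) {C θ : ℝ} (hC : 0 ≤ C) (hθ : ((L : ℝ)⁻¹) ≤ θ) (hθ1 : θ < 1)
    (hNE3θ : LocalRate (bgReadings L M (regClass L M R)) C θ)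
    {P₄ : (k : ℕ) → Matrix (idx L M k × o) (idx L M k × o) ℂ} {κ₄ C₄ : ℝ}
    (hP₄ : PerturbationLaws (fun k => calDalev L M a ha k ⊗ₖ (1 : Matrix o o ℂ)) P₄ (fun k => JpcT L M k ⊗ₖ (1 : Matrix o o ℂ)) κ₄
      (fun k => C₄ * θ ^ k)) (hsmall : kappaBs o d a α β (a * (epsR o d α * (2 + epsR o d α) * Cst d a)) κ₄ < 1) :
    TowerLimitRate (fun k => Qlev L M k ⊗ₖ (1 : Matrix o o ℂ)) ((L : ℝ) ^ d)
      (fun k => (calDalev L M a ha k ⊗ₖ (1 : Matrix o o ℂ) + balabanPert L M a R P₄ k)⁻¹)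
      (Cpert (kappaBs o d a α β (a * (epsR o d α * (2 + epsR o d α) * Cst d a)) κ₄) (2 * d * Cst d a) (CJ d a)
        (C2Bs o d L a α β C
          (a * C2gram (Cst d a) 1 (epsR o d α) (2 * d * Cst d a) (CJ d a) (Cst d a) (CdeltaR o d a α (theta0 d α (betaNE3 o C)))) C₄)
        0 1) θ := by
  have h := balaban_rate_sharp_rate L M a ha hd hreg hC hθ hθ1 hNE3θ hP₄ (t := 1) (by rwa [norm_one, one_mul])
  simpa only [one_smul] using h

/-- **`t = 1` UNDER THE RECORD's EXPLICIT NUMBERS, AT RATE `θ`**: `α, β, epsR o d α, κ₄ ≤ η ≤ 1`, `η·KstarR < 1` ⟹ `κ < 1`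
(`NE2BalabanLayerSharp.kappaBs_balaban_le_of_small`, θ-free). [folklore] -/
theorem balaban_rate_of_small_sharp_rate (hd : 1 ≤ d) {R : (k : ℕ) → Fin d → (idx L M k → Matrix o o ℂ)} {α β : ℝ}
    (hreg : RegularTransporters L M R α β) {C θ : ℝ} (hC : 0 ≤ C) (hθ : ((L : ℝ)⁻¹) ≤ θ) (hθ1 : θ < 1)
    (hNE3θ : LocalRate (bgReadings L M (regClass L M R)) C θ)
    {P₄ : (k : ℕ) → Matrix (idx L M k × o) (idx L M k × o) ℂ} {κ₄ C₄ : ℝ}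
    (hP₄ : PerturbationLaws (fun k => calDalev L M a ha k ⊗ₖ (1 : Matrix o o ℂ)) P₄ (fun k => JpcT L M k ⊗ₖ (1 : Matrix o o ℂ)) κ₄
      (fun k => C₄ * θ ^ k)) {η : ℝ} (hαη : α ≤ η) (hβη : β ≤ η) (hεη : epsR o d α ≤ η) (hκη : κ₄ ≤ η) (hη1 : η ≤ 1)
    (hηK : η * KstarR o d a < 1) :
    TowerLimitRate (fun k => Qlev L M k ⊗ₖ (1 : Matrix o o ℂ)) ((L : ℝ) ^ d)
      (fun k => (calDalev L M a ha k ⊗ₖ (1 : Matrix o o ℂ) + balabanPert L M a R P₄ k)⁻¹)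
      (Cpert (kappaBs o d a α β (a * (epsR o d α * (2 + epsR o d α) * Cst d a)) κ₄) (2 * d * Cst d a) (CJ d a)
        (C2Bs o d L a α β C
          (a * C2gram (Cst d a) 1 (epsR o d α) (2 * d * Cst d a) (CJ d a) (Cst d a) (CdeltaR o d a α (theta0 d α (betaNE3 o C)))) C₄)
        0 1) θ :=
  balaban_rate_at_one_sharp_rate L M a ha hd hreg hC hθ hθ1 hNE3θ hP₄
    ((kappaBs_balaban_le_of_small a ha.le hreg.nonneg.1 (epsR_nonneg (o := o) (d := d) hreg.nonneg.1) hαη hβη hεη hκη hη1).trans_lt hηK)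


/-! ## §2 On row data: the gauge slot discharged by part 3, the END under the record's explicit threshold `etaStar` -/

/-- **THE TYPED TIER-B PERTURBATION ON ROW DATA IN THE TARGET SHAPE AT RATE `θ`** (`d ≥ 1`, `L⁻¹ ≤ θ ≤ 1`, `a′ > 0`): for site-based bond
transporters `Rg` in row B5's (3.35)-shape class whose coefficient towers `{w, Dw}` obey node NE3's `LocalRate … C θ` (BY NAME, OPEN), and the two
B4 numeric thresholds: `PerturbationLaws (Δ_a ⊗ 1) (balabanPert (liftR Rg) (gaugeSlot Rg (QuT (siteT Rg)) Q1 a′)) (J ⊗ 1) κ_B (C₂^B·θ^k)`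
with EXACTLY the record's `κ_B = kappaBs … (kappaQ d a a (epsR o d α)) (kappa4F d a a′ α β)` and `C₂^B = C2Bs … (C4F …)` —
`NE2BalabanFinal.perturbationLaws_balaban_final` with `hNE3` at rate `θ`; gauge slot by part 3's
`GaugeTermSlotRegularRate.perturbationLaws_gaugeSlot_regular_rate` (leaf-05-g4).  NE2 is NOT proved by this.
[cite: Balaban1985BackgroundPropagators, (3.19) p.393, (3.25) p.394, (3.26) p.395 (shapes)] [folklore] -/
theorem perturbationLaws_balaban_final_rate (hd : 1 ≤ d) {Rg : (k : ℕ) → Fin d → (Tor (fine (lev L k) M) → Matrix o o ℂ)}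
    {α β : ℝ} (hreg : RegularTransporters L M (liftR L M Rg) α β) {C θ : ℝ} (hC : 0 ≤ C) (hθ : ((L : ℝ)⁻¹) ≤ θ) (hθle : θ ≤ 1)
    (hNE3θ : LocalRate (bgReadings L M (regClass L M (liftR L M Rg))) C θ) {a' : ℝ} (ha' : 0 < a')
    (hκ : kappaS d a' α β (tauR d α) < 1)
    (hsmall : ((sigma0 d a') ^ 2)⁻¹ * deltaK (gS d a' (kappaS d a' α β (tauR d α))) (1 + tauR d α) (d * α) (tauR d α) a' < 1) :
    PerturbationLaws (fun k => calDalev L M a ha k ⊗ₖ (1 : Matrix o o ℂ))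
      (balabanPert L M a (liftR L M Rg) (gaugeSlot L M Rg (QuT L M o (siteT L M Rg)) (Q1 L M o) a'))
      (fun k => JpcT L M k ⊗ₖ (1 : Matrix o o ℂ))
      (kappaBs o d a α β (kappaQ d a (a : ℂ) (epsR o d α)) (kappa4F d a a' α β))
      (fun k => C2Bs o d L a α β C
        (a * C2gram (Cst d a) 1 (epsR o d α) (2 * d * Cst d a) (CJ d a) (Cst d a) (CdeltaR o d a α (theta0 d α (betaNE3 o C))))
        (C4F o d L a a' α β C) * θ ^ k) :=
  perturbationLaws_balaban_sharp_rate L M a ha hd hreg hC hθ hNE3θ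
    (GaugeTermSlotRegularRate.perturbationLaws_gaugeSlot_regular_rate L M a ha hd hreg hC hθ hθle hNE3θ ha' hκ hsmall)

/-- **ROOT B AT `t = 1` ON ROW DATA AT RATE `θ`, THE RECORD's EXPLICIT NUMBERS** (`d ≥ 1`, `L⁻¹ ≤ θ < 1`):
`α, β, epsR o d α, kappa4F … ≤ η ≤ 1`,
`η·KstarR < 1` and the two B4 thresholds — `NE2BalabanFinal.balaban_final_rate_of_small` with `hNE3` at rate `θ`. [folklore] -/
theorem balaban_final_rate_of_small_rate (hd : 1 ≤ d) {Rg : (k : ℕ) → Fin d → (Tor (fine (lev L k) M) → Matrix o o ℂ)}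
    {α β : ℝ} (hreg : RegularTransporters L M (liftR L M Rg) α β) {C θ : ℝ} (hC : 0 ≤ C) (hθ : ((L : ℝ)⁻¹) ≤ θ) (hθ1 : θ < 1)
    (hNE3θ : LocalRate (bgReadings L M (regClass L M (liftR L M Rg))) C θ) {a' : ℝ} (ha' : 0 < a')
    (hκ : kappaS d a' α β (tauR d α) < 1)
    (hsmall : ((sigma0 d a') ^ 2)⁻¹ * deltaK (gS d a' (kappaS d a' α β (tauR d α))) (1 + tauR d α) (d * α) (tauR d α) a' < 1)
    {η : ℝ} (hαη : α ≤ η) (hβη : β ≤ η) (hεη : epsR o d α ≤ η) (hκη : kappa4F d a a' α β ≤ η) (hη1 : η ≤ 1)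
    (hηK : η * KstarR o d a < 1) :
    TowerLimitRate (fun k => Qlev L M k ⊗ₖ (1 : Matrix o o ℂ)) ((L : ℝ) ^ d)
      (fun k => (calDalev L M a ha k ⊗ₖ (1 : Matrix o o ℂ)
        + balabanPert L M a (liftR L M Rg) (gaugeSlot L M Rg (QuT L M o (siteT L M Rg)) (Q1 L M o) a') k)⁻¹)
      (Cpert (kappaBs o d a α β (a * (epsR o d α * (2 + epsR o d α) * Cst d a)) (kappa4F d a a' α β))
        (2 * d * Cst d a) (CJ d a)
        (C2Bs o d L a α β C
          (a * C2gram (Cst d a) 1 (epsR o d α) (2 * d * Cst d a) (CJ d a) (Cst d a) (CdeltaR o d a α (theta0 d α (betaNE3 o C))))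
          (C4F o d L a a' α β C)) 0 1) θ :=
  balaban_rate_of_small_sharp_rate L M a ha hd hreg hC hθ hθ1 hNE3θ
    (GaugeTermSlotRegularRate.perturbationLaws_gaugeSlot_regular_rate L M a ha hd hreg hC hθ hθ1.le hNE3θ ha' hκ hsmall)
    hαη hβη hεη hκη hη1 hηK

/-- **ROW B8 END — ROOT B OF RECORD RE-TYPED AT A GENERAL GEOMETRIC RATE `θ ∈ [L⁻¹, 1)`** (owner ruling R19 (c); `d ≥ 1`, `a′ > 0`): for
site-based bond transporters `Rg` in row B5's (3.35)-shape class (`α, β`) whose coefficient towers `{w, Dw}` obey NODE NE3's `LocalRate … C θ` (BY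
NAME, OPEN — now at ANY geometric rate `θ ≥ L⁻¹`), and ONE explicit threshold `α, β ≤ η ≤ etaStar(card o, d, a, a′)` (the SAME `etaStar` —
it does not see `θ`): the lifted King-averaged unit-lattice covariances of `(Δ_a^{(k)} ⊗ 1 + P_k)⁻¹`, `P` the typed model of `Δ_a(U) − Δ_a ⊗ 1`
(covariant Laplacian + Bałaban's covariant line-sum averaging + gauge term with site transports along the (1.7) legs), CONVERGE as `k → ∞` with rate `θ^k`.
This is `NE2BalabanThreshold.balaban_final_rate_of_regular` with every binder kept except the rate (`hL : 2 ≤ L` is implied by `L⁻¹ ≤ θ < 1`); the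
NE2 side can now consume a node-NE3 supply at any such rate; NE3's supply itself OPEN; model level (no B0); NOT [B9] (3.23)–(3.26) as printed;
NE2 (U1a) is NOT proved by this (c1). [folklore] -/
theorem balaban_final_rate_of_regular_rate (hd : 1 ≤ d) {Rg : (k : ℕ) → Fin d → (Tor (fine (lev L k) M) → Matrix o o ℂ)}
    {α β : ℝ} (hreg : RegularTransporters L M (liftR L M Rg) α β) {C θ : ℝ} (hC : 0 ≤ C) (hθ : ((L : ℝ)⁻¹) ≤ θ) (hθ1 : θ < 1)
    (hNE3θ : LocalRate (bgReadings L M (regClass L M (liftR L M Rg))) C θ) {a' : ℝ} (ha' : 0 < a')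
    {η : ℝ} (hαη : α ≤ η) (hβη : β ≤ η) (hη : η ≤ etaStar o d a a') :
    TowerLimitRate (fun k => Qlev L M k ⊗ₖ (1 : Matrix o o ℂ)) ((L : ℝ) ^ d)
      (fun k => (calDalev L M a ha k ⊗ₖ (1 : Matrix o o ℂ)
        + balabanPert L M a (liftR L M Rg) (gaugeSlot L M Rg (QuT L M o (siteT L M Rg)) (Q1 L M o) a') k)⁻¹)
      (Cpert (kappaBs o d a α β (a * (epsR o d α * (2 + epsR o d α) * Cst d a)) (kappa4F d a a' α β))
        (2 * d * Cst d a) (CJ d a)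
        (C2Bs o d L a α β C
          (a * C2gram (Cst d a) 1 (epsR o d α) (2 * d * Cst d a) (CJ d a) (Cst d a) (CdeltaR o d a α (theta0 d α (betaNE3 o C))))
          (C4F o d L a a' α β C)) 0 1) θ := by
  obtain ⟨h1, h2, h3, h4, h5, h6, h7, h8⟩ :=
    smallness_of_le (o := o) (d := d) a ha.le ha' hreg.nonneg.1 hreg.nonneg.2 hαη hβη hη
  exact balaban_final_rate_of_small_rate L M a ha hd hreg hC hθ hθ1 hNE3θ ha' h1 h2 h3 h4 h5 h6 h7 h8

/-- **THE INSTANCE OF RECORD IS THE CASE `θ = L⁻¹`** (kernel `example` — as a named corollary it would restate the record, `dedup.landed`):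
`NE2BalabanThreshold.balaban_final_rate_of_regular`'s statement re-derived from the general-rate END at `θ = L⁻¹` by `exact` (`L ≥ 2` gives
`L⁻¹ < 1`); the record is neither edited nor superseded. [folklore] -/
example (hL : 2 ≤ L) (hd : 1 ≤ d)
    {Rg : (k : ℕ) → Fin d → (Tor (fine (lev L k) M) → Matrix o o ℂ)}
    {α β : ℝ} (hreg : RegularTransporters L M (liftR L M Rg) α β) {C : ℝ} (hC : 0 ≤ C)
    (hNE3 : LocalRate (bgReadings L M (regClass L M (liftR L M Rg))) C ((L : ℝ)⁻¹)) {a' : ℝ} (ha' : 0 < a')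
    {η : ℝ} (hαη : α ≤ η) (hβη : β ≤ η) (hη : η ≤ etaStar o d a a') :
    TowerLimitRate (fun k => Qlev L M k ⊗ₖ (1 : Matrix o o ℂ)) ((L : ℝ) ^ d)
      (fun k => (calDalev L M a ha k ⊗ₖ (1 : Matrix o o ℂ)
        + balabanPert L M a (liftR L M Rg) (gaugeSlot L M Rg (QuT L M o (siteT L M Rg)) (Q1 L M o) a') k)⁻¹)
      (Cpert (kappaBs o d a α β (a * (epsR o d α * (2 + epsR o d α) * Cst d a)) (kappa4F d a a' α β))
        (2 * d * Cst d a) (CJ d a)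
        (C2Bs o d L a α β C
          (a * C2gram (Cst d a) 1 (epsR o d α) (2 * d * Cst d a) (CJ d a) (Cst d a) (CdeltaR o d a α (theta0 d α (betaNE3 o C))))
          (C4F o d L a a' α β C)) 0 1) ((L : ℝ)⁻¹) := by
  have hL1 : (1 : ℝ) < L := by exact_mod_cast (lt_of_lt_of_le one_lt_two hL : 1 < L)
  exact balaban_final_rate_of_regular_rate L M a ha hd hreg hC le_rfl (inv_lt_one_of_one_lt₀ hL1) hNE3 ha' hαη hβη hη

end Summit.QuantumFields.BalabanUV.T4Continuum.NE2BalabanFinalRate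

end
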